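import Summits.CriticalPhenomena.SAWScalingLimit.Theorems.SAWDevelopingMapInteriorFlatteningLiouvilleDefs
import Summits.CriticalPhenomena.SAWScalingLimit.Theses.SAWDevelopingMap
import Literature.Probability.RandomPlanarGeometry.HexDomainSingleton
import Literature.Probability.RandomPlanarGeometry.HexParafermionTransport
import Literature.Probability.LatticeModels.TriangularLatticeProofs

/-!
# The core stub S5 of line `liouville-local-limits` is NECESSARY: the crux forces every local limit to be the constant `1/3`

Crux `stmt-CriticalPhenomena-8297` (`…Theses.SAWDevelopingMap.InteriorFlattening`), line `liouville-local-limits`, lead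
`prover-line-stmt-CriticalPhenomena-8297-c1-0`, own stub `stub_pictureLimitsUnique` (S5). TOOL / necessity record, not a closure:
`Necessity.fieldBelt_eq_zero_vertex_const` (flat in every frame at a vertex ⇒ one value on its three edges, `ω ≠ ω²`),
`Necessity.hexGraph_preconnected` (from `hexDomainSimplyConnected_singleton`) ⇒ `Necessity.edge_const` (flat everywhere ⇒ constant
on edges); the crux makes every element of `LocalLimits` / `PicLimits` flat at every vertex (a fixed vertex is eventually deep along
the defining sequence; `‖belt‖ ≤ ε‖mono‖` passes to the limit for every `ε`), hence equal to `constThird`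
(`localLimits_subset_of_interiorFlattening`, `picLimits_subset_of_interiorFlattening`), so `PicLimits.Subsingleton`
(`picLimits_subsingleton_of_interiorFlattening`, registered sub-goal) and `LocalLimits.Subsingleton` follow from the crux: the line
loses nothing at its core. Sources: the line card `Cruxes/InteriorFlattening/Lines/liouville-local-limits.md`; H. Duminil-Copin,
S. Smirnov, Ann. of Math. 175 (2012), for the objects.
-/

noncomputable section

open scoped BigOperators Topology
open Filter Literature.Probability.LatticeModels Literature.Probability.RandomPlanarGeometry.SAW

namespace Summit.CriticalPhenomena.SAWScalingLimit.Theorems.InteriorFlattening.Liouville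

namespace Necessity

/-- `ω = ζ²` for `ζ = e^{iπ/3}`. -/
theorem omega_eq_triZeta_sq : omega = triZeta ^ 2 := by
  rw [omega, triZeta, sq, ← Complex.exp_add]
  congr 1
  ring

/-- `ζ² = ζ - 1`. -/
theorem triZeta_sq : triZeta ^ 2 = triZeta - 1 := by
  rw [HV.triZeta_eq_omg]; exact HV.omg_sq

/-- `ω - ω² = 2ζ - 1 (= i√3)`. -/
theorem omega_sub_omega_sq : omega - omega ^ 2 = 2 * triZeta - 1 := by
  rw [omega_eq_triZeta_sq]
  have h := triZeta_sq
  linear_combination (1 - triZeta - triZeta ^ 2) * h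

/-- `ω ≠ ω²`. -/
theorem omega_sub_omega_sq_ne_zero : omega - omega ^ 2 ≠ 0 := by
  rw [omega_sub_omega_sq]
  intro h
  have := congrArg Complex.im h
  simp [triZeta_im] at this

/-- The three neighbours of a vertex `v`, explicitly: a triple `n₀ n₁ n₂` of pairwise distinct
vertices with `hexGraph.Adj v w ↔ w = n₀ ∨ w = n₁ ∨ w = n₂`. -/
theorem exists_three_neighbours (v : HexVertex) :
    ∃ n₀ n₁ n₂ : HexVertex, n₀ ≠ n₁ ∧ n₁ ≠ n₂ ∧ n₀ ≠ n₂ ∧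
      ∀ w : HexVertex, hexGraph.Adj v w ↔ w = n₀ ∨ w = n₁ ∨ w = n₂ := by
  obtain ⟨x, j⟩ := v
  have h0 : (Pi.single 0 1 : Site 2) ≠ 0 := fun e => by simpa using congrFun e 0
  have h1 : (Pi.single 1 1 : Site 2) ≠ 0 := fun e => by simpa using congrFun e 1
  have h01 : (Pi.single 0 1 : Site 2) ≠ Pi.single 1 1 := fun e => by simpa using congrFun e 0
  fin_cases j
  · refine ⟨(x, 1), (x - Pi.single 0 1, 1), (x - Pi.single 1 1, 1), ?_, ?_, ?_, ?_⟩
    · exact fun e => h0 (sub_eq_self.1 ((Prod.ext_iff.1 e).1).symm)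
    · simp only [ne_eq, Prod.mk.injEq, sub_right_inj, and_true]; exact h01
    · exact fun e => h1 (sub_eq_self.1 ((Prod.ext_iff.1 e).1).symm)
    · rintro ⟨y, l⟩
      fin_cases l
      · constructor
        · intro h; exact absurd h (not_hexGraph_adj_of_snd_eq_holds _ _ rfl)
        · rintro (h | h | h) <;> simp at h
      · simp only [Fin.mk_one, Fin.isValue, Prod.mk.injEq, and_true]
        exact hexGraph_adj_iff_of_snd_eq_zero_holds x y
  · refine ⟨(x, 0), (x + Pi.single 0 1, 0), (x + Pi.single 1 1, 0), ?_, ?_, ?_, ?_⟩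
    · exact fun e => h0 (add_left_cancel ((add_zero x).trans (Prod.ext_iff.1 e).1)).symm
    · simp only [ne_eq, Prod.mk.injEq, add_right_inj, and_true]; exact h01
    · exact fun e => h1 (add_left_cancel ((add_zero x).trans (Prod.ext_iff.1 e).1)).symm
    · rintro ⟨y, l⟩
      fin_cases l
      · simp only [Fin.zero_eta, Fin.isValue, Prod.mk.injEq, and_true]
        exact hexGraph_adj_iff_of_snd_eq_one x y
      · constructor
        · intro h; exact absurd h (not_hexGraph_adj_of_snd_eq_holds _ _ rfl)
        · rintro (h | h | h) <;> simp at h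

/-- Given two distinct neighbours `w, w'` of `v`, the third neighbour. -/
theorem exists_third_neighbour {v w w' : HexVertex} (hw : hexGraph.Adj v w) (hw' : hexGraph.Adj v w')
    (hne : w ≠ w') : ∃ w'' : HexVertex, hexGraph.Adj v w'' ∧ w'' ≠ w ∧ w'' ≠ w' := by
  obtain ⟨n₀, n₁, n₂, h01, h12, h02, hiff⟩ := exists_three_neighbours v
  rcases (hiff w).1 hw with rfl | rfl | rfl <;> rcases (hiff w').1 hw' with rfl | rfl | rfl
  · exact absurd rfl hne
  · exact ⟨n₂, (hiff n₂).2 (Or.inr (Or.inr rfl)), h02.symm, h12.symm⟩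
  · exact ⟨n₁, (hiff n₁).2 (Or.inr (Or.inl rfl)), h01.symm, h12⟩
  · exact ⟨n₂, (hiff n₂).2 (Or.inr (Or.inr rfl)), h12.symm, h02.symm⟩
  · exact absurd rfl hne
  · exact ⟨n₀, (hiff n₀).2 (Or.inl rfl), h01, h02⟩
  · exact ⟨n₁, (hiff n₁).2 (Or.inr (Or.inl rfl)), h12, h01.symm⟩
  · exact ⟨n₀, (hiff n₀).2 (Or.inl rfl), h02, h01⟩
  · exact absurd rfl hne

/-- A field is FLAT AT `v`: its `ω`-combination vanishes in every frame at `v`. -/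
def FlatAt (G : Sym2 HexVertex → ℂ) (v : HexVertex) : Prop :=
  ∀ w₀ w₁ w₂ : HexVertex, hexGraph.Adj v w₀ → hexGraph.Adj v w₁ → hexGraph.Adj v w₂ →
    w₀ ≠ w₁ → w₁ ≠ w₂ → w₀ ≠ w₂ → fieldBelt G v w₀ w₁ w₂ = 0

/-- **Flat at `v` ⇒ one value on the three edges of `v`**: the frames `(w'', w, w')` and
`(w'', w', w)` give `G₀ + ωG + ω²G' = 0 = G₀ + ωG' + ω²G`, so `(ω - ω²)(G - G') = 0`. -/
theorem fieldBelt_eq_zero_vertex_const {G : Sym2 HexVertex → ℂ} {v : HexVertex} (hflat : FlatAt G v)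
    {w w' : HexVertex} (hw : hexGraph.Adj v w) (hw' : hexGraph.Adj v w') : G s(v, w) = G s(v, w') := by
  by_cases hne : w = w'
  · rw [hne]
  obtain ⟨w'', hw'', h1, h2⟩ := exists_third_neighbour hw hw' hne
  have e1 := hflat w'' w w' hw'' hw hw' h1 hne h2
  have e2 := hflat w'' w' w hw'' hw' hw h2 (Ne.symm hne) h1
  simp only [fieldBelt] at e1 e2
  have h : (omega - omega ^ 2) * (G s(v, w) - G s(v, w')) = 0 := by linear_combination e1 - e2
  rcases mul_eq_zero.1 h with h | h
  · exact absurd h omega_sub_omega_sq_ne_zero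
  · exact sub_eq_zero.1 h

/-- `O ≠ A`. -/
theorem O_ne_nbA : O ≠ nbA := fun h => by have := congrArg Prod.snd h; simp [O, nbA] at this
/-- `O ≠ B`. -/
theorem O_ne_nbB : O ≠ nbB := fun h => by have := congrArg Prod.snd h; simp [O, nbB] at this
/-- `A ≠ B`. -/
theorem nbA_ne_nbB : nbA ≠ nbB := fun h => by
  have := congrArg (fun p : HexVertex => p.1 0) h; simp [nbA, nbB] at this

/-- Among the three distinct vertices `O, A, B` one differs from both `u` and `u'`. -/
theorem exists_ne_ne (u u' : HexVertex) : ∃ v₀ : HexVertex, v₀ ≠ u ∧ v₀ ≠ u' := by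
  by_cases hOu : O = u
  · by_cases hAu' : nbA = u'
    · refine ⟨nbB, ?_, ?_⟩
      · rw [← hOu]; exact O_ne_nbB.symm
      · rw [← hAu']; exact nbA_ne_nbB.symm
    · refine ⟨nbA, ?_, hAu'⟩
      rw [← hOu]; exact O_ne_nbA.symm
  · by_cases hOu' : O = u'
    · by_cases hAu : nbA = u
      · refine ⟨nbB, ?_, ?_⟩
        · rw [← hAu]; exact nbA_ne_nbB.symm
        · rw [← hOu']; exact O_ne_nbB.symm
      · refine ⟨nbA, hAu, ?_⟩
        rw [← hOu']; exact O_ne_nbA.symm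
    · exact ⟨O, hOu, hOu'⟩

/-- **The honeycomb lattice is preconnected** (the complement of any vertex is, by the
Literature fact `hexDomainSimplyConnected_singleton`; embed that induced subgraph). -/
theorem hexGraph_preconnected : hexGraph.Preconnected := by
  intro u u'
  obtain ⟨v₀, hv₀u, hv₀u'⟩ := exists_ne_ne u u'
  have hsc := hexDomainSimplyConnected_singleton v₀
  have hu : u ∈ ((↑({v₀} : Finset HexVertex) : Set HexVertex)ᶜ) := by simpa using hv₀u.symm
  have hu' : u' ∈ ((↑({v₀} : Finset HexVertex) : Set HexVertex)ᶜ) := by simpa using hv₀u'.symm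
  have hr := hsc ⟨u, hu⟩ ⟨u', hu'⟩
  exact hr.map (SimpleGraph.Embedding.induce _).toHom

/-- **Flat at every vertex ⇒ constant on edges**: along a walk from `O`, consecutive edges share
a vertex. -/
theorem edge_const {G : Sym2 HexVertex → ℂ} (hflat : ∀ v, FlatAt G v) :
    ∀ v w : HexVertex, hexGraph.Adj v w → G s(v, w) = G s(O, nbA) := by
  have hOA : hexGraph.Adj O nbA := (hexGraph_adj_iff_of_snd_eq_zero_holds 0 0).2 (Or.inl rfl)
  -- propagation along a walk: if all edges at the start carry the value, so do all edges at the end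
  have key : ∀ {u v : HexVertex} (p : hexGraph.Walk u v),
      (∀ w, hexGraph.Adj u w → G s(u, w) = G s(O, nbA)) →
        ∀ w, hexGraph.Adj v w → G s(v, w) = G s(O, nbA) := by
    intro u v p
    induction p with
    | nil => exact id
    | @cons a b c hab p ih =>
      intro ha
      refine ih fun w hw => ?_
      -- at `b`: the edge to `w` and the edge back to `a` carry the same value
      have h1 : G s(b, w) = G s(b, a) := fieldBelt_eq_zero_vertex_const (hflat _) hw hab.symm
      rw [h1, Sym2.eq_swap]
      exact ha b hab
  intro v w hvw
  obtain ⟨p⟩ := hexGraph_preconnected O v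
  exact key p (fun w' hw' => fieldBelt_eq_zero_vertex_const (hflat _) hw' hOA) w hvw

/-- The field `1/3` on edges, `0` off edges: the only possible local limit under the crux. -/
def constThird : Sym2 HexVertex → ℂ := fun z => if z ∈ hexGraph.edgeSet then 1 / 3 else 0

/-- A field flat at every vertex, vanishing off edges, with monopole `1` at `O`, IS `constThird`. -/
theorem eq_constThird {G : Sym2 HexVertex → ℂ} (hflat : ∀ v, FlatAt G v)
    (hoff : ∀ z : Sym2 HexVertex, z ∉ hexGraph.edgeSet → G z = 0) (hnorm : fieldMono G O nbA nbB nbC = 1) :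
    G = constThird := by
  have hOA : hexGraph.Adj O nbA := (hexGraph_adj_iff_of_snd_eq_zero_holds 0 0).2 (Or.inl rfl)
  have hOB : hexGraph.Adj O nbB := (hexGraph_adj_iff_of_snd_eq_zero_holds 0 _).2 (Or.inr (Or.inl (by simp)))
  have hOC : hexGraph.Adj O nbC := (hexGraph_adj_iff_of_snd_eq_zero_holds 0 _).2 (Or.inr (Or.inr (by simp)))
  have hc := edge_const hflat
  have hthird : G s(O, nbA) = 1 / 3 := by
    have h3 : 3 * G s(O, nbA) = 1 := by
      rw [← hnorm, fieldMono, hc O nbB hOB, hc O nbC hOC]; ring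
    linear_combination h3 / 3
  funext z
  by_cases hz : z ∈ hexGraph.edgeSet
  · simp only [constThird, if_pos hz]
    induction z using Sym2.ind with
    | h v w => rw [hc v w ((SimpleGraph.mem_edgeSet _).1 hz), hthird]
  · simp only [constThird, if_neg hz, hoff z hz]

/-- `a ≤ ε b` for every `ε > 0` forces `a ≤ 0`. -/
theorem nonpos_of_forall_le_eps_mul {a b : ℝ} (hb : 0 ≤ b) (h : ∀ ε : ℝ, 0 < ε → a ≤ ε * b) : a ≤ 0 := by
  by_contra ha
  push Not at ha
  have h1 := h (a / (2 * (b + 1))) (by positivity)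
  have hb1 : 0 < b + 1 := by linarith
  have : a / (2 * (b + 1)) * b ≤ a / 2 := by
    rw [div_mul_eq_mul_div, div_le_div_iff₀ (by positivity) (by norm_num)]
    nlinarith
  linarith

/-- The `ω`-combination and the monopole of a normalised field are the normalised ones. -/
theorem fieldBelt_div (F : Sym2 HexVertex → ℂ) (M : ℂ) (v w₀ w₁ w₂ : HexVertex) :
    fieldBelt (fun z => F z / M) v w₀ w₁ w₂ = fieldBelt F v w₀ w₁ w₂ / M := by
  simp only [fieldBelt]; ring

/-- The monopole of a normalised field is the normalised monopole. -/
theorem fieldMono_div (F : Sym2 HexVertex → ℂ) (M : ℂ) (v w₀ w₁ w₂ : HexVertex) :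
    fieldMono (fun z => F z / M) v w₀ w₁ w₂ = fieldMono F v w₀ w₁ w₂ / M := by
  simp only [fieldMono]; ring

/-- Pointwise convergence on the three edges of a frame gives convergence of the `ω`-combination. -/
theorem tendsto_fieldBelt {H : ℕ → Sym2 HexVertex → ℂ} {G : Sym2 HexVertex → ℂ} {v w₀ w₁ w₂ : HexVertex}
    (h₀ : Tendsto (fun n => H n s(v, w₀)) atTop (𝓝 (G s(v, w₀))))
    (h₁ : Tendsto (fun n => H n s(v, w₁)) atTop (𝓝 (G s(v, w₁))))
    (h₂ : Tendsto (fun n => H n s(v, w₂)) atTop (𝓝 (G s(v, w₂)))) :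
    Tendsto (fun n => fieldBelt (H n) v w₀ w₁ w₂) atTop (𝓝 (fieldBelt G v w₀ w₁ w₂)) := by
  simp only [fieldBelt]
  exact (h₀.add (h₁.const_mul omega)).add (h₂.const_mul (omega ^ 2))

/-- Pointwise convergence on the three edges of a frame gives convergence of the monopole. -/
theorem tendsto_fieldMono {H : ℕ → Sym2 HexVertex → ℂ} {G : Sym2 HexVertex → ℂ} {v w₀ w₁ w₂ : HexVertex}
    (h₀ : Tendsto (fun n => H n s(v, w₀)) atTop (𝓝 (G s(v, w₀))))
    (h₁ : Tendsto (fun n => H n s(v, w₁)) atTop (𝓝 (G s(v, w₁))))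
    (h₂ : Tendsto (fun n => H n s(v, w₂)) atTop (𝓝 (G s(v, w₂)))) :
    Tendsto (fun n => fieldMono (H n) v w₀ w₁ w₂) atTop (𝓝 (fieldMono G v w₀ w₁ w₂)) := by
  simp only [fieldMono]
  exact (h₀.add h₁).add h₂

/-- A vertex at distance `≤ d` from `c_O` is `R`-deep in any domain in which `O` is `(R + d)`-deep,
and belongs to it once `0 ≤ R`. -/
theorem deep_of_deep_O {Λ : Finset HexVertex} {v : HexVertex} {R d t : ℝ}
    (hv : dist (hexCenter v) (hexCenter O) ≤ d) (ht : R + d ≤ t) (hdeep : Deep Λ O t) : Deep Λ v R := by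
  intro w hw
  refine hdeep w ?_
  calc dist (hexCenter w) (hexCenter O) ≤ dist (hexCenter w) (hexCenter v) + dist (hexCenter v) (hexCenter O) :=
        dist_triangle _ _ _
    _ ≤ R + d := add_le_add hw hv
    _ ≤ t := ht

/-- **Flatness of limits under the crux.** If `G` is the pointwise limit on edges of normalised
observables `obs (D n) (ρ n) · / M n` of simply connected domains with boundary roots in which `O`
is `n`-deep, then the crux (M) makes `G` flat at every vertex. -/
theorem flatAt_of_limit (hM : Summit.CriticalPhenomena.SAWScalingLimit.Theses.SAWDevelopingMap.InteriorFlattening)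
    {D : ℕ → Finset HexVertex} {ρ : ℕ → Sym2 HexVertex} {M : ℕ → ℂ} {G : Sym2 HexVertex → ℂ}
    (hsc : ∀ n, hexDomainSimplyConnected (D n)) (hρ : ∀ n, ρ n ∈ hexDomainBoundary (D n))
    (hdeep : ∀ n, Deep (D n) O n)
    (hlim : ∀ z ∈ hexGraph.edgeSet, Tendsto (fun n => obs (D n) (ρ n) z / M n) atTop (𝓝 (G z))) :
    ∀ v, FlatAt G v := by
  intro v w₀ w₁ w₂ h₀ h₁ h₂ h01 h12 h02
  set d : ℝ := dist (hexCenter v) (hexCenter O)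
  -- convergence of the two modes along the normalised sequence
  set H : ℕ → Sym2 HexVertex → ℂ := fun n z => obs (D n) (ρ n) z / M n with hH
  have hB := tendsto_fieldBelt (H := H) (hlim _ ((SimpleGraph.mem_edgeSet _).2 h₀))
    (hlim _ ((SimpleGraph.mem_edgeSet _).2 h₁)) (hlim _ ((SimpleGraph.mem_edgeSet _).2 h₂))
  have hS := tendsto_fieldMono (H := H) (hlim _ ((SimpleGraph.mem_edgeSet _).2 h₀))
    (hlim _ ((SimpleGraph.mem_edgeSet _).2 h₁)) (hlim _ ((SimpleGraph.mem_edgeSet _).2 h₂))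
  -- for every ε the inequality holds eventually, hence in the limit
  have key : ∀ ε : ℝ, 0 < ε → ‖fieldBelt G v w₀ w₁ w₂‖ ≤ ε * ‖fieldMono G v w₀ w₁ w₂‖ := by
    intro ε hε
    obtain ⟨R, hR⟩ := hM ε hε
    obtain ⟨N, hN⟩ := exists_nat_ge (max R 0 + d)
    refine le_of_tendsto_of_tendsto hB.norm (hS.norm.const_mul ε) ?_
    rw [Filter.EventuallyLE, Filter.eventually_atTop]
    refine ⟨N, fun n hn => ?_⟩
    have hn' : max R 0 + d ≤ (n : ℝ) := hN.trans (by exact_mod_cast hn)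
    have hvR : Deep (D n) v R := by
      refine deep_of_deep_O le_rfl ?_ (hdeep n)
      linarith [le_max_left R 0]
    have hvmem : v ∈ D n := hdeep n v (by linarith [le_max_right R 0])
    -- the crux at (D n, ρ n, v)
    have hcrux := hR (D n) (hsc n) (ρ n) (hρ n) v hvmem hvR w₀ w₁ w₂ h₀ h₁ h₂ h01 h12 h02
    dsimp only at hcrux
    -- normalise
    have e1 : fieldBelt (H n) v w₀ w₁ w₂ = fieldBelt (obs (D n) (ρ n)) v w₀ w₁ w₂ / M n := fieldBelt_div _ _ _ _ _ _
    have e2 : fieldMono (H n) v w₀ w₁ w₂ = fieldMono (obs (D n) (ρ n)) v w₀ w₁ w₂ / M n := fieldMono_div _ _ _ _ _ _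
    show ‖fieldBelt (H n) v w₀ w₁ w₂‖ ≤ ε * ‖fieldMono (H n) v w₀ w₁ w₂‖
    rw [e1, e2, norm_div, norm_div, ← mul_div_assoc]
    exact div_le_div_of_nonneg_right (by simpa [fieldBelt, fieldMono, obs, omega] using hcrux) (norm_nonneg _)
  have h0 : ‖fieldBelt G v w₀ w₁ w₂‖ ≤ 0 := nonpos_of_forall_le_eps_mul (norm_nonneg _) key
  exact norm_le_zero_iff.1 h0

end Necessity

open Necessity

/-- **Under the crux every local limit is the constant field `1/3`.** -/
theorem localLimits_subset_of_interiorFlattening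
    (hM : Summit.CriticalPhenomena.SAWScalingLimit.Theses.SAWDevelopingMap.InteriorFlattening) :
    LocalLimits ⊆ {constThird} := by
  intro G hG
  obtain ⟨hoff, Λ, a, hadm, hmono, hlim⟩ := hG
  rw [Set.mem_singleton_iff]
  have hflat : ∀ v, FlatAt G v :=
    flatAt_of_limit hM (fun n => (hadm n).1) (fun n => (hadm n).2.1) (fun n => (hadm n).2.2) hlim
  refine eq_constThird hflat hoff ?_
  -- the normalisation passes to the limit: each approximant has monopole 1 at O
  have hOA : hexGraph.Adj O nbA := (hexGraph_adj_iff_of_snd_eq_zero_holds 0 0).2 (Or.inl rfl)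
  have hOB : hexGraph.Adj O nbB := (hexGraph_adj_iff_of_snd_eq_zero_holds 0 _).2 (Or.inr (Or.inl (by simp)))
  have hOC : hexGraph.Adj O nbC := (hexGraph_adj_iff_of_snd_eq_zero_holds 0 _).2 (Or.inr (Or.inr (by simp)))
  have hS := tendsto_fieldMono (H := fun n z => obs (Λ n) (a n) z / obsMono (Λ n) (a n))
    (hlim _ ((SimpleGraph.mem_edgeSet _).2 hOA)) (hlim _ ((SimpleGraph.mem_edgeSet _).2 hOB))
    (hlim _ ((SimpleGraph.mem_edgeSet _).2 hOC))
  have h1 : Tendsto (fun n => fieldMono (fun z => obs (Λ n) (a n) z / obsMono (Λ n) (a n)) O nbA nbB nbC)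
      atTop (𝓝 1) := by
    refine tendsto_const_nhds.congr fun n => ?_
    rw [fieldMono_div]
    exact (div_self (hmono n)).symm
  exact tendsto_nhds_unique hS h1

/-- **Under the crux `LocalLimits` is a subsingleton** (the conclusion of S7 is necessary). -/
theorem localLimits_subsingleton_of_interiorFlattening
    (hM : Summit.CriticalPhenomena.SAWScalingLimit.Theses.SAWDevelopingMap.InteriorFlattening) :
    LocalLimits.Subsingleton :=
  (Set.subsingleton_singleton).anti (localLimits_subset_of_interiorFlattening hM)

namespace Necessity

/-- `latticeBall` is monotone in the radius. -/
theorem latticeBall_mono {s t : ℝ} (h : s ≤ t) : latticeBall s ⊆ latticeBall t := fun _ hw =>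
  mem_latticeBall_iff.2 ((mem_latticeBall_iff.1 hw).trans h)

/-- Unfolding membership in `Pic S`: intrusions inside the ball, dart `y → z` with `y` in the shell
`B_{S+1} ∖ B_S`, `z ∈ B_S`, `y ∼ z`. -/
theorem mem_Pic_iff {S : ℝ} {P : Picture} :
    P ∈ Pic S ↔ P.1 ⊆ latticeBall S ∧ P.2.1 ∈ latticeBall (S + 1) ∧ P.2.1 ∉ latticeBall S ∧
      P.2.2 ∈ latticeBall S ∧ hexGraph.Adj P.2.1 P.2.2 := by
  simp only [Pic, darts, Finset.mem_product, Finset.mem_powerset, Finset.mem_filter, Finset.mem_sdiff]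
  tauto

/-- The dart of a good picture is a BOUNDARY root of its picture domain `B_S ∖ P.1`. -/
theorem picRoot_mem_boundary {S : ℝ} {P : Picture} (hP : P ∈ Pic S) (hgood : GoodPic S P) :
    picRoot P ∈ hexDomainBoundary (latticeBall S \ P.1) := by
  obtain ⟨-, -, hyS, hz, hadj⟩ := mem_Pic_iff.1 hP
  refine ⟨(SimpleGraph.mem_edgeSet _).2 hadj, P.2.1, P.2.2, rfl, ?_, ?_⟩
  · exact Finset.mem_sdiff.2 ⟨hz, hgood.2⟩
  · exact fun h => hyS (Finset.mem_sdiff.1 h).1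

/-- In an `n`-clean picture domain of scale `S ≥ n` the origin is `n`-deep. -/
theorem deep_picDom {S n : ℝ} {P : Picture} (hn : n ≤ S) (hclean : Clean n P) :
    Deep (latticeBall S \ P.1) O n := by
  intro w hw
  have hwn : w ∈ latticeBall n := mem_latticeBall_iff.2 hw
  exact Finset.mem_sdiff.2 ⟨latticeBall_mono hn hwn, Finset.disjoint_right.1 hclean hwn⟩

end Necessity

/-- **Under the crux every picture limit is the constant field `1/3`.** -/
theorem picLimits_subset_of_interiorFlattening
    (hM : Summit.CriticalPhenomena.SAWScalingLimit.Theses.SAWDevelopingMap.InteriorFlattening) :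
    PicLimits ⊆ {constThird} := by
  intro G hG
  obtain ⟨hoff, S, P, hP, hmono, hlim⟩ := hG
  rw [Set.mem_singleton_iff]
  have hflat : ∀ v, FlatAt G v :=
    flatAt_of_limit hM (D := fun n => latticeBall (S n) \ (P n).1) (ρ := fun n => picRoot (P n))
      (M := fun n => picMono (S n) (P n))
      (fun n => (hP n).2.2.1.1) (fun n => picRoot_mem_boundary (hP n).2.1 (hP n).2.2.1)
      (fun n => deep_picDom (hP n).1 (hP n).2.2.2) hlim
  refine eq_constThird hflat hoff ?_
  have hOA : hexGraph.Adj O nbA := (hexGraph_adj_iff_of_snd_eq_zero_holds 0 0).2 (Or.inl rfl)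
  have hOB : hexGraph.Adj O nbB := (hexGraph_adj_iff_of_snd_eq_zero_holds 0 _).2 (Or.inr (Or.inl (by simp)))
  have hOC : hexGraph.Adj O nbC := (hexGraph_adj_iff_of_snd_eq_zero_holds 0 _).2 (Or.inr (Or.inr (by simp)))
  have hS := tendsto_fieldMono (H := fun n z => picField (S n) (P n) z / picMono (S n) (P n))
    (hlim _ ((SimpleGraph.mem_edgeSet _).2 hOA)) (hlim _ ((SimpleGraph.mem_edgeSet _).2 hOB))
    (hlim _ ((SimpleGraph.mem_edgeSet _).2 hOC))
  have h1 : Tendsto (fun n => fieldMono (fun z => picField (S n) (P n) z / picMono (S n) (P n)) O nbA nbB nbC)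
      atTop (𝓝 1) := by
    refine tendsto_const_nhds.congr fun n => ?_
    rw [fieldMono_div]
    exact (div_self (hmono n)).symm
  exact tendsto_nhds_unique hS h1

/-- **S5 is necessary**: under the crux `PicLimits` is a subsingleton (registered sub-goal of the crux
item; the lead's stub `stub_pictureLimitsUnique` asserts the same under bulk no-fold only). -/
theorem picLimits_subsingleton_of_interiorFlattening :
    Summit.CriticalPhenomena.SAWScalingLimit.Theses.SAWDevelopingMap.InteriorFlattening → PicLimits.Subsingleton :=
  fun hM => (Set.subsingleton_singleton).anti (picLimits_subset_of_interiorFlattening hM)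

end Summit.CriticalPhenomena.SAWScalingLimit.Theorems.InteriorFlattening.Liouville

end
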